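import Literature.NumberTheory.EllipticCurves.Kato2004.KummerFrameOfTorsionTower
import HarnessLib

/-!
# Kato 2004 (Astérisque 295) §15.5 — (F∃)-2a: a NORM-COMPATIBLE UNIT TOWER on a Kummer frame from level
# representatives that are norm-compatible UP TO TWELFTH ROOTS OF UNITY (the `μ₁₂`-correction), and the
# `p`-group lemma `[V_s : V_{s+1}] = pᵃ` (`s ≥ 1`) for the torsion tower

Topic `NumberTheory/EllipticCurves`, sub-directory `Kato2004` (declarations under `KummerFrame.…`).  Three definitions
with bodies (`KummerFrame.cosetNorm`, `KummerFrame.corrUnits`, `KummerFrame.towerUnits`) and theorems: **no named fact**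
(D-0026); no instance, no notation, no `sorry`.  Number field `K`, ANY `E : WeierstrassCurve K`, ANY prime `p`; no complex
multiplication inside.

WHY (planner `bsd-cm` D1043 (3)–(4), D1045 (5), D1046 (C), D1050 (B): the unit-tower half `(F∃)_K-2` of the hypothesis `hF`
of `CM.prop159_ellipticUnits_expStar_values_of_kummerCup`, `Kato2004/EllipticUnitKummerCupValues.lean`).  Kato's elliptic
units `_𝔞z_{pˢ𝔣}` (§15.5, p. 253: «the norm map of `K(p^{n+1}𝔣)/K(pⁿ𝔣)` sends `_𝔞z_{p^{n+1}𝔣}` to `_𝔞z_{pⁿ𝔣}`») are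
available in the tree only through REPRESENTATIVES `u_s` with `ι̂(u_s)^{12} = Θ(1; pˢ𝔣, 𝔞)` (`IsKatoUnitRep`, determined up
to `μ₁₂` — de Shalit's `Θ = (_𝔞θ_E)^{12}`, II.2.3 (10)), whose norms therefore satisfy `N_{K_{s+1}/K_s} u_{s+1} = ζ₀ · u_s`
with `ζ₀^{12} = 1` only (the Summit-side `exists_normOver_katoUnitRep_eq_mul`, from de Shalit II.2.5 (i)); a
`KummerFrame.UnitTower` (field `norm_z`) needs the EXACT relation.  THIS FILE, on ANY Kummer frame `F` (§3): given level
representatives `r s` (`s ≥ 1`) fixed by `V s`, norm-compatible up to twelfth roots of unity in the frame's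
coset-product currency (`((F.cosetNorm s (r (s+1)) : K̄ˣ) : K̄) = ζ₀ · r s`, `ζ₀^{12} = 1`), and two-sidedly `p`-integral
(`pᵏ r_s`, `pᵏ r_s⁻¹ ∈ ℤ̄` — the second conjunct of `mem_pUnitsOf_iff`), IF every index `d_s = [V s : V (s+1)]` (`s ≥ 1`) is
prime to `12`, THEN the EXPLICIT recursion `z₁ := r₁`, `z_{s+1} := (z_s · N_s(r_{s+1})⁻¹)^{d_s} · r_{s+1}`,
`z₀ := N₀(z₁)` is a unit tower on `F` with `z_s = η_s · r_s`, `η_s^{12} = 1`, `η_s` fixed by `V s` (`s ≥ 1`).  The point: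
`θ_s := z_s · N_s(r_{s+1})⁻¹ = η_s ζ₀⁻¹` is a `V s`-invariant twelfth root of unity, so `N_s(θ_s^{d_s}) = θ_s^{d_s²} = θ_s`
because `d² ≡ 1 (mod 12)` for every `d` prime to `12` (`(ℤ/12)^×` has exponent `2`) — no choice is made.  The level-`0`
unit `N₀(z₁)` carries no pin (Kato's generators are `(_𝔞z_{pⁿ𝔣})_{n ≥ 1}`; planner D1043 (1)) and its `p`-unit property
(b5) follows from that of `z₁` by integrality of Galois conjugates (§2).  For the torsion-tower frame
`KummerFrame.ofTorsionTower` (F∃-1) the index hypothesis is PROVED for `p ∤ 12` (§4: `σ ∈ Gal(K̄/K(E[m]))`, `p ∣ m` ⟹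
`σᵖ ∈ Gal(K̄/K(E[pm]))`, so `V_s/V_{s+1}` is a `p`-group for `s ≥ 1`).  The Summit-side sequel (F∃)-2b feeds Kato's
representatives (`Kato2004.sec155_exists_katoUnitRep`, `exists_normOver_katoUnitRep_eq_mul`, `prod_smul_eq_normOver_of_eq`,
`CM.torsionLayer_eq_fixingSubgroup_katoLayer`) into `exists_unitTower_ofTorsionTower_of_reps`.

* §1 `KummerFrame.cosetNorm F s u = ∏ᶠ_{x ∈ V_s/V_{s+1}} x̃ • u` and its API: `prod_smul_eq_cosetNorm` (any section, any
  `Fintype` instance — the letter of field `UnitTower.norm_z`), `coe_cosetNorm_eq_prod_smul` (the same in `K̄`, the bridge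
  to `prod_smul_eq_normOver_of_eq`), `cosetNorm_mul`, `cosetNorm_inv`, `cosetNorm_eq_pow_of_forall_smul_eq`
  (`= ζ^{[V_s:V_{s+1}]}` on `V_s`-invariants), `smul_cosetNorm_of_mem` (`N_{V_s/V_{s+1}} u` is `V_s`-invariant).
* §2 integrality: `isIntegral_smul` (Galois conjugates of algebraic integers), `isIntegral_pow_mul_cosetNorm`,
  `isIntegral_of_pow_twelve_eq_one`, `punit_of_isIntegral` (the letter of field `UnitTower.punit_z` from two-sided
  `p`-integrality).
* §3 `mul_self_mod_twelve_of_coprime` (`d·d ≡ 1 (mod 12)`), `pow_pow_self_eq_of_pow_twelve`, the recursion `corrUnits` /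
  `towerUnits`, the invariant `exists_corrUnits_eq_mul`, the norm relation `cosetNorm_corrUnits_succ`, and
  ★★ `exists_unitTower_of_reps`.
* §4 torsion tower: `pow_mem_torsionLayer_mul`, `exists_card_quotient_torsionLayer_eq_pow`,
  `coprime_card_quotient_ofTorsionTower`, ★★ `exists_unitTower_ofTorsionTower_of_reps` (the F∃-2b input).

Dictionary `ℚ ↔ K`: none.  GENERALISE-VS-DUPLICATE: new notion `cosetNorm` (the frame's own norm on `K̄ˣ`; the tree's
`normOver` lives on intermediate fields and is bridged Summit-side by `prod_smul_eq_normOver_of_eq` — not duplicated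
here) and the two recursions; engines BY NAME: `KummerFrame`/`UnitTower`/`V_succ_le`/`isOpen_V`
(`EllipticUnitKummerCupMap`), `KummerFrame.ofTorsionTower`, `smul_eq_of_mem_torsionLayer`, `mem_torsionLayer_of_forall_smul_eq`
(`KummerFrameOfTorsionTower`), `finiteIndex_of_isOpen_of_compactSpace`, Mathlib `map_isIntegral_int`, `IsIntegral.prod`,
`IsPGroup.iff_card`; nothing re-declared.  CONSUMER BY NAME: (F∃)-2b `exists_unitTower_of_katoReps` → `hF` of
`CM.prop159_ellipticUnits_expStar_values_of_kummerCup` → the `euK` column of `GenusSeven.PinnedKatoGenusFrame`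
(crux stmt-BirchSwinnertonDyer-19945, route K7r).  HONEST FRAMING: group / Galois bookkeeping on an abstract frame;
proves nothing about any particular curve; no summit statement is proved.

## References

* [Kato2004Asterisque] K. Kato, Astérisque 295 (2004), §15.5 (p. 253: `_𝔞z_𝔣 := _𝔞θ_E(α)`, «the norm map of
  `K(p^{n+1}𝔣)/K(pⁿ𝔣)` sends `_𝔞z_{p^{n+1}𝔣}` to `_𝔞z_{pⁿ𝔣}`», `O_{K'}[1/p]^×`), §15.3 (15.3.1) (p. 252), §15.1 (p. 251).
* [deShalit1987] E. de Shalit, *Iwasawa Theory of Elliptic Curves with Complex Multiplication* (1987), II.1.7 Corollary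
  (conjugates of primitive division points), II.2.3 (10) (`Θ = θ^{12}`), II.2.4 (ii)–(iii), II.2.5 Proposition (i) (norm
  relation of the `Θ`-values).
* [JohnsonLeungKings2011] J. Johnson-Leung, G. Kings (2011), Prop. 3.3 (1)(2) (the `p`-units and their norm compatibility).
* [NeukirchSchmidtWingberg2008] J. Neukirch, A. Schmidt, K. Wingberg (2008), (1.2.5) (open subgroups of profinite groups
  have finite index), I §5 (1.5.7) (corestriction in degree `0` is the norm `∑_{x ∈ U'/U} x̃`).
* [Lang1983] S. Lang, *Fundamentals of Diophantine Geometry* (1983), Ch. 6 Prop. 1.3 (units away from `p`).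
-/

noncomputable section

open scoped NumberField
open Field IsDedekindDomain
open Literature.NumberTheory.GaloisRepresentations
open Literature.NumberTheory.EllipticCurves
open WeierstrassCurve (geomPoints geomTorsion)

namespace Literature.NumberTheory.EllipticCurves.Kato2004

namespace KummerFrame

variable {K : Type} [Field K] [NumberField K] {E : WeierstrassCurve K} {p : ℕ} [Fact p.Prime] (F : KummerFrame E p)

/-! ## §1 The coset norm `N_{V_s/V_{s+1}}` of the frame -/

omit [Fact (Nat.Prime p)] in
/-- The coset space `V_s / V_{s+1}` of a Kummer frame is finite (`V_{s+1}` is open in the compact `Γ_K`).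
[cite: NeukirchSchmidtWingberg2008, (1.2.5)] -/
theorem finite_quotient_V (s : ℕ) : Finite (F.V s ⧸ (F.V (s + 1)).subgroupOf (F.V s)) := by
  haveI : (F.V (s + 1)).FiniteIndex := finiteIndex_of_isOpen_of_compactSpace _ (F.isOpen_V (s + 1))
  infer_instance

/-- **`N_{V_s/V_{s+1}}(u) = ∏_{x ∈ V_s/V_{s+1}} x̃ • u`** for the chosen representatives `x̃ = Quotient.out x` — the norm
`N_{K(p^{s+1}𝔣)/K(pˢ𝔣)}` in the frame's coset-product currency (for `V_{s+1}`-invariant `u` it is independent of the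
representatives, `prod_smul_eq_cosetNorm`); a finite product (`finite_quotient_V`).
[cite: Kato2004Asterisque, §15.5 (p. 253)] [cite: NeukirchSchmidtWingberg2008, I §5 (1.5.7)] -/
def cosetNorm (s : ℕ) (u : (AlgebraicClosure K)ˣ) : (AlgebraicClosure K)ˣ :=
  ∏ᶠ x : F.V s ⧸ (F.V (s + 1)).subgroupOf (F.V s), ((Quotient.out x : F.V s) : absoluteGaloisGroup K) • u

omit [NumberField K] [Fact (Nat.Prime p)] in
/-- `cosetNorm` as a `Finset` product, for any `Fintype` structure on the coset space.
[cite: NeukirchSchmidtWingberg2008, I §5 (1.5.7)] -/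
theorem cosetNorm_eq_prod (s : ℕ) [Fintype (F.V s ⧸ (F.V (s + 1)).subgroupOf (F.V s))] (u : (AlgebraicClosure K)ˣ) :
    F.cosetNorm s u =
      ∏ x : F.V s ⧸ (F.V (s + 1)).subgroupOf (F.V s), ((Quotient.out x : F.V s) : absoluteGaloisGroup K) • u :=
  finprod_eq_prod_of_fintype _

omit [NumberField K] [Fact (Nat.Prime p)] in
/-- Two representatives of the same coset of `V_{s+1}` in `V_s` act alike on a `V_{s+1}`-invariant.
[cite: NeukirchSchmidtWingberg2008, I §5 (1.5.7)] -/
theorem smul_eq_smul_of_coe_eq (s : ℕ) {u : (AlgebraicClosure K)ˣ}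
    (hu : ∀ σ : F.V (s + 1), (σ : absoluteGaloisGroup K) • u = u)
    {a b : F.V s} (h : (a : F.V s ⧸ (F.V (s + 1)).subgroupOf (F.V s)) = b) :
    (a : absoluteGaloisGroup K) • u = (b : absoluteGaloisGroup K) • u := by
  have hab : ((a⁻¹ * b : F.V s) : absoluteGaloisGroup K) ∈ F.V (s + 1) :=
    Subgroup.mem_subgroupOf.mp (QuotientGroup.eq.mp h)
  have hab' : (a : absoluteGaloisGroup K)⁻¹ * b ∈ F.V (s + 1) := by
    simpa only [Subgroup.coe_mul, Subgroup.coe_inv] using hab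
  have key : ((a : absoluteGaloisGroup K)⁻¹ * b) • u = u := hu ⟨_, hab'⟩
  rw [mul_smul, inv_smul_eq_iff] at key
  exact key.symm

omit [NumberField K] [Fact (Nat.Prime p)] in
/-- **Independence of the representatives**: for `V_{s+1}`-invariant `u`, every section `t` of `V_s → V_s/V_{s+1}` and
every `Fintype` structure on the coset space give `∏ₓ t(x) • u = N_{V_s/V_{s+1}}(u)` — the letter of the field
`KummerFrame.UnitTower.norm_z`. [cite: Kato2004Asterisque, §15.5 (p. 253)] [cite: NeukirchSchmidtWingberg2008, I §5 (1.5.7)] -/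
theorem prod_smul_eq_cosetNorm (s : ℕ) [Fintype (F.V s ⧸ (F.V (s + 1)).subgroupOf (F.V s))]
    (t : F.V s ⧸ (F.V (s + 1)).subgroupOf (F.V s) → F.V s)
    (ht : ∀ x, (t x : F.V s ⧸ (F.V (s + 1)).subgroupOf (F.V s)) = x)
    {u : (AlgebraicClosure K)ˣ} (hu : ∀ σ : F.V (s + 1), (σ : absoluteGaloisGroup K) • u = u) :
    ∏ x, ((t x : F.V s) : absoluteGaloisGroup K) • u = F.cosetNorm s u := by
  rw [cosetNorm_eq_prod]
  exact Finset.prod_congr rfl fun x _ ↦ F.smul_eq_smul_of_coe_eq s hu ((ht x).trans (QuotientGroup.out_eq' x).symm)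

omit [NumberField K] [Fact (Nat.Prime p)] in
/-- **The coset norm read in `K̄`**: `(N_{V_s/V_{s+1}}(u) : K̄) = ∏ₓ t(x) • (u : K̄)` for any section `t` and any `Fintype`
structure — the form that the Summit-side bridge `prod_smul_eq_normOver_of_eq` turns into `normOver (K_{s+1}) (K_s)`.
[cite: Kato2004Asterisque, §15.5 (p. 253)] [cite: NeukirchSchmidtWingberg2008, I §5 (1.5.7)] -/
theorem coe_cosetNorm_eq_prod_smul (s : ℕ) [Fintype (F.V s ⧸ (F.V (s + 1)).subgroupOf (F.V s))]
    (t : F.V s ⧸ (F.V (s + 1)).subgroupOf (F.V s) → F.V s)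
    (ht : ∀ x, (t x : F.V s ⧸ (F.V (s + 1)).subgroupOf (F.V s)) = x)
    {u : (AlgebraicClosure K)ˣ} (hu : ∀ σ : F.V (s + 1), (σ : absoluteGaloisGroup K) • u = u) :
    ((F.cosetNorm s u : (AlgebraicClosure K)ˣ) : AlgebraicClosure K) =
      ∏ x, ((t x : F.V s) : absoluteGaloisGroup K) • (u : AlgebraicClosure K) := by
  rw [← F.prod_smul_eq_cosetNorm s t ht hu, Units.coe_prod]
  exact Finset.prod_congr rfl fun x _ ↦ Units.coe_smul _ _

omit [Fact (Nat.Prime p)] in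
/-- `N(uv) = N(u)N(v)`. [cite: NeukirchSchmidtWingberg2008, I §5 (1.5.7)] -/
theorem cosetNorm_mul (s : ℕ) (u v : (AlgebraicClosure K)ˣ) :
    F.cosetNorm s (u * v) = F.cosetNorm s u * F.cosetNorm s v := by
  haveI := F.finite_quotient_V s
  haveI := Fintype.ofFinite (F.V s ⧸ (F.V (s + 1)).subgroupOf (F.V s))
  rw [cosetNorm_eq_prod, cosetNorm_eq_prod, cosetNorm_eq_prod, ← Finset.prod_mul_distrib]
  exact Finset.prod_congr rfl fun x _ ↦ smul_mul' _ _ _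

omit [Fact (Nat.Prime p)] in
/-- `N(u⁻¹) = N(u)⁻¹`. [cite: NeukirchSchmidtWingberg2008, I §5 (1.5.7)] -/
theorem cosetNorm_inv (s : ℕ) (u : (AlgebraicClosure K)ˣ) : F.cosetNorm s u⁻¹ = (F.cosetNorm s u)⁻¹ := by
  haveI := F.finite_quotient_V s
  haveI := Fintype.ofFinite (F.V s ⧸ (F.V (s + 1)).subgroupOf (F.V s))
  rw [cosetNorm_eq_prod, cosetNorm_eq_prod, ← Finset.prod_inv_distrib]
  exact Finset.prod_congr rfl fun x _ ↦ smul_inv' _ _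

omit [Fact (Nat.Prime p)] in
/-- **`N_{V_s/V_{s+1}}(ζ) = ζ^{[V_s : V_{s+1}]}`** for a `V_s`-invariant `ζ`. [cite: NeukirchSchmidtWingberg2008, I §5 (1.5.7)] -/
theorem cosetNorm_eq_pow_of_forall_smul_eq (s : ℕ) {ζ : (AlgebraicClosure K)ˣ}
    (hζ : ∀ σ : F.V s, (σ : absoluteGaloisGroup K) • ζ = ζ) :
    F.cosetNorm s ζ = ζ ^ Nat.card (F.V s ⧸ (F.V (s + 1)).subgroupOf (F.V s)) := by
  haveI := F.finite_quotient_V s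
  haveI := Fintype.ofFinite (F.V s ⧸ (F.V (s + 1)).subgroupOf (F.V s))
  rw [cosetNorm_eq_prod, Finset.prod_congr rfl fun x _ ↦ hζ _, Finset.prod_const, Finset.card_univ,
    Nat.card_eq_fintype_card]

omit [Fact (Nat.Prime p)] in
/-- **`N_{V_s/V_{s+1}}(u)` is `V_s`-invariant** for `V_{s+1}`-invariant `u` (left multiplication by `τ ∈ V_s` permutes
the cosets, and the product does not depend on the representatives). [cite: NeukirchSchmidtWingberg2008, I §5 (1.5.7)] -/
theorem smul_cosetNorm_of_mem (s : ℕ) {u : (AlgebraicClosure K)ˣ}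
    (hu : ∀ σ : F.V (s + 1), (σ : absoluteGaloisGroup K) • u = u) (τ : F.V s) :
    (τ : absoluteGaloisGroup K) • F.cosetNorm s u = F.cosetNorm s u := by
  haveI := F.finite_quotient_V s
  haveI := Fintype.ofFinite (F.V s ⧸ (F.V (s + 1)).subgroupOf (F.V s))
  rw [cosetNorm_eq_prod, Finset.smul_prod']
  simp_rw [← mul_smul, ← Subgroup.coe_mul]
  refine Fintype.prod_equiv (MulAction.toPerm τ) _ _ fun x ↦ F.smul_eq_smul_of_coe_eq s hu ?_
  rw [MulAction.toPerm_apply, QuotientGroup.out_eq', ← MulAction.Quotient.coe_smul_out, smul_eq_mul]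

/-! ## §2 Integrality: Galois conjugates, coset norms, twelfth roots of unity, and the `p`-unit letter (b5) -/

omit [NumberField K] in
/-- **Galois conjugates of algebraic integers are algebraic integers** (`σ` is a ring homomorphism).
[cite: Lang1983, Ch. 6 Prop. 1.3] -/
theorem isIntegral_smul (σ : absoluteGaloisGroup K) {x : AlgebraicClosure K} (hx : IsIntegral ℤ x) :
    IsIntegral ℤ (σ • x) := by
  rw [Field.absoluteGaloisGroup.smul_def]
  exact map_isIntegral_int (Field.absoluteGaloisGroup.toAlgEquiv K σ) hx

omit [NumberField K] in
/-- `σ • n = n` for a rational integer `n ∈ K ⊆ K̄`. [cite: Kato2004Asterisque, §15.1 (p. 251)] -/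
theorem smul_natCast_eq (σ : absoluteGaloisGroup K) (n : ℕ) : σ • (n : AlgebraicClosure K) = n := by
  rw [← map_natCast (algebraMap K (AlgebraicClosure K)) n, smul_algebraMap]

omit [NumberField K] [Fact (Nat.Prime p)] in
/-- `pᵏ·x ∈ ℤ̄ ⟹ pᵏ·(σ • x) ∈ ℤ̄`. [cite: Lang1983, Ch. 6 Prop. 1.3] -/
theorem isIntegral_pow_mul_smul (σ : absoluteGaloisGroup K) (k : ℕ) {x : AlgebraicClosure K}
    (hx : IsIntegral ℤ ((p : AlgebraicClosure K) ^ k * x)) :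
    IsIntegral ℤ ((p : AlgebraicClosure K) ^ k * σ • x) := by
  have h := isIntegral_smul σ hx
  rwa [smul_mul', smul_pow', smul_natCast_eq] at h

omit [Fact (Nat.Prime p)] in
/-- **Two-sided `p`-integrality passes to coset norms**: `pᵏ·u ∈ ℤ̄ ⟹ p^{k·[V_s:V_{s+1}]}·N_{V_s/V_{s+1}}(u) ∈ ℤ̄`
(a product of `[V_s:V_{s+1}]` Galois conjugates of `pᵏu`). [cite: Kato2004Asterisque, §15.5 (p. 253: `_𝔞z ∈ O[1/p]^×`)]
[cite: Lang1983, Ch. 6 Prop. 1.3] -/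
theorem isIntegral_pow_mul_cosetNorm (s : ℕ) {u : (AlgebraicClosure K)ˣ} {k : ℕ}
    (hk : IsIntegral ℤ ((p : AlgebraicClosure K) ^ k * (u : AlgebraicClosure K))) :
    IsIntegral ℤ ((p : AlgebraicClosure K) ^ (k * Nat.card (F.V s ⧸ (F.V (s + 1)).subgroupOf (F.V s))) *
      ((F.cosetNorm s u : (AlgebraicClosure K)ˣ) : AlgebraicClosure K)) := by
  haveI := F.finite_quotient_V s
  haveI := Fintype.ofFinite (F.V s ⧸ (F.V (s + 1)).subgroupOf (F.V s))
  rw [cosetNorm_eq_prod, Units.coe_prod, Nat.card_eq_fintype_card, pow_mul, ← Finset.card_univ, ← Finset.prod_const,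
    ← Finset.prod_mul_distrib]
  exact IsIntegral.prod _ fun x _ ↦ by rw [Units.coe_smul]; exact isIntegral_pow_mul_smul _ k hk

omit [NumberField K] [Fact (Nat.Prime p)] in
/-- A twelfth root of unity is an algebraic integer. [cite: deShalit1987, II.2.3 (10)] -/
theorem isIntegral_of_pow_twelve_eq_one {η : (AlgebraicClosure K)ˣ} (hη : η ^ 12 = 1) :
    IsIntegral ℤ (η : AlgebraicClosure K) :=
  IsIntegral.of_pow (by norm_num : 0 < 12)
    (by rw [← Units.val_pow_eq_pow_val, hη, Units.val_one]; exact isIntegral_one)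

omit [NumberField K] [Fact (Nat.Prime p)] in
/-- `pᵏ·u ∈ ℤ̄` and `η^{12} = 1` ⟹ `pᵏ·(η u) ∈ ℤ̄`. [cite: deShalit1987, II.2.3 (10)] -/
theorem isIntegral_pow_mul_mul_of_pow_twelve {η u : (AlgebraicClosure K)ˣ} (hη : η ^ 12 = 1) {k : ℕ}
    (hk : IsIntegral ℤ ((p : AlgebraicClosure K) ^ k * (u : AlgebraicClosure K))) :
    IsIntegral ℤ ((p : AlgebraicClosure K) ^ k * ((η * u : (AlgebraicClosure K)ˣ) : AlgebraicClosure K)) := by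
  rw [Units.val_mul, mul_left_comm]
  exact (isIntegral_of_pow_twelve_eq_one hη).mul hk

omit [NumberField K] [Fact (Nat.Prime p)] in
/-- **The `p`-unit letter (b5) of `KummerFrame.UnitTower.punit_z` from two-sided `p`-integrality**: if `pᵏu` and `pᵏu⁻¹`
are algebraic integers then `a := pᵏu ∈ ℤ̄_K` lies in no prime `𝔓` of `ℤ̄_K` above a place `v ∤ p` (`a · (pᵏu⁻¹) =
p^{2k} ∉ 𝔓`). [cite: Kato2004Asterisque, §15.1 (p. 251: `O_{K'}[1/p]^×`) and §15.5 (p. 253)] [cite: Lang1983, Ch. 6 Prop. 1.3] -/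
theorem punit_of_isIntegral {u : (AlgebraicClosure K)ˣ} {k : ℕ}
    (hk : IsIntegral ℤ ((p : AlgebraicClosure K) ^ k * (u : AlgebraicClosure K)))
    (hk' : IsIntegral ℤ ((p : AlgebraicClosure K) ^ k * (u⁻¹ : (AlgebraicClosure K)ˣ).val)) :
    ∃ (m : ℕ) (a : absIntegers (𝓞 K) K),
      (a : AlgebraicClosure K) = (p : AlgebraicClosure K) ^ m * (u : AlgebraicClosure K) ∧
        ∀ v : HeightOneSpectrum (𝓞 K), ((p : ℕ) : 𝓞 K) ∉ v.asIdeal → ∀ 𝔓 ∈ v.primesAbove, a ∉ 𝔓 := by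
  have ha : IsIntegral (𝓞 K) ((p : AlgebraicClosure K) ^ k * (u : AlgebraicClosure K)) := hk.tower_top
  have hb : IsIntegral (𝓞 K) ((p : AlgebraicClosure K) ^ k * (u⁻¹ : (AlgebraicClosure K)ˣ).val) := hk'.tower_top
  refine ⟨k, ⟨_, ha⟩, rfl, fun v hv 𝔓 h𝔓 hmem ↦ ?_⟩
  haveI : 𝔓.IsPrime := (HeightOneSpectrum.mem_primesAbove_iff.mp h𝔓).1
  haveI : 𝔓.LiesOver v.asIdeal := (HeightOneSpectrum.mem_primesAbove_iff.mp h𝔓).2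
  have hq : ((p : absIntegers (𝓞 K) K) : AlgebraicClosure K) = (p : AlgebraicClosure K) :=
    map_natCast (absIntegers (𝓞 K) K).val p
  have hp𝔓 : (p : absIntegers (𝓞 K) K) ∉ 𝔓 := by
    intro hmem'
    have h1 : algebraMap (𝓞 K) (absIntegers (𝓞 K) K) (p : 𝓞 K) ∈ 𝔓 := by rwa [map_natCast]
    rw [← Ideal.mem_comap, ← Ideal.under_def, ← Ideal.LiesOver.over (P := 𝔓) (p := v.asIdeal)] at h1
    exact hv h1
  have hab : (⟨_, ha⟩ : absIntegers (𝓞 K) K) * ⟨_, hb⟩ = (p : absIntegers (𝓞 K) K) ^ (k + k) := Subtype.ext (by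
    rw [MulMemClass.coe_mul, SubmonoidClass.coe_pow, hq]
    change (p : AlgebraicClosure K) ^ k * (u : AlgebraicClosure K) *
      ((p : AlgebraicClosure K) ^ k * (u⁻¹ : (AlgebraicClosure K)ˣ).val) = _
    rw [mul_mul_mul_comm, Units.mul_inv, mul_one, pow_add])
  have h2 : (p : absIntegers (𝓞 K) K) ^ (k + k) ∈ 𝔓 := by
    rw [← hab]
    exact Ideal.mul_mem_right _ _ hmem
  exact hp𝔓 (‹𝔓.IsPrime›.mem_of_pow_mem _ h2)

/-! ## §3 The `μ₁₂`-correction: `d² ≡ 1 (mod 12)`, the recursion, the invariant, the norm relation, the unit tower -/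

/-- **`d·d ≡ 1 (mod 12)` for `d` prime to `12`** — `(ℤ/12ℤ)^× = {±1, ±5}` has exponent `2`. [cite: deShalit1987, II.2.3 (10)
(the `μ₁₂`-ambiguity of `θ`)] -/
theorem mul_self_mod_twelve_of_coprime {d : ℕ} (hd : d.Coprime 12) : d * d % 12 = 1 := by
  have hc : (d % 12).Coprime 12 := by
    unfold Nat.Coprime at hd ⊢
    rwa [← Nat.gcd_rec, Nat.gcd_comm]
  have hlt : d % 12 < 12 := Nat.mod_lt _ (by norm_num)
  rw [Nat.mul_mod]
  generalize d % 12 = m at hc hlt ⊢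
  interval_cases m <;> first | decide | exact absurd hc (by decide)

/-- **`(θᵈ)ᵈ = θ`** for a twelfth root of unity `θ` and `d` prime to `12`. [cite: deShalit1987, II.2.3 (10)] -/
theorem pow_pow_self_eq_of_pow_twelve {M : Type*} [Monoid M] {θ : M} (hθ : θ ^ 12 = 1) {d : ℕ} (hd : d.Coprime 12) :
    (θ ^ d) ^ d = θ := by
  rw [← pow_mul, ← Nat.div_add_mod (d * d) 12, mul_self_mod_twelve_of_coprime hd, pow_add, pow_mul, hθ, one_pow, one_mul,
    pow_one]

/-- **The corrected units at the levels `≥ 1`** (`corrUnits F r t = z_{t+1}`): `z₁ := r₁`,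
`z_{t+2} := (z_{t+1} · N_{t+1}(r_{t+2})⁻¹)^{[V_{t+1} : V_{t+2}]} · r_{t+2}` — the `μ₁₂`-correction of the representatives
`r` that makes the norm relation exact (`cosetNorm_corrUnits_succ`), with no choice involved.
[cite: Kato2004Asterisque, §15.5 (p. 253)] [cite: deShalit1987, II.2.5 Proposition (i) and II.2.3 (10)] -/
def corrUnits (r : ℕ → (AlgebraicClosure K)ˣ) : ℕ → (AlgebraicClosure K)ˣ
  | 0 => r 1
  | t + 1 => (corrUnits r t * (F.cosetNorm (t + 1) (r (t + 2)))⁻¹) ^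
      Nat.card (F.V (t + 1) ⧸ (F.V (t + 2)).subgroupOf (F.V (t + 1))) * r (t + 2)

/-- **The corrected unit tower** (`towerUnits F r s = z_s`): `z₀ := N₀(z₁)` (Kato's generators are `(_𝔞z_{pⁿ𝔣})_{n ≥ 1}`;
the level-`0` unit is the norm of the level-`1` unit), `z_{t+1} := corrUnits F r t`.
[cite: Kato2004Asterisque, §15.5 (p. 253)] -/
def towerUnits (r : ℕ → (AlgebraicClosure K)ˣ) : ℕ → (AlgebraicClosure K)ˣ
  | 0 => F.cosetNorm 0 (r 1)
  | t + 1 => F.corrUnits r t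

omit [NumberField K] [Fact (Nat.Prime p)] in
/-- Unfolding: `z₁ = r₁`. [cite: Kato2004Asterisque, §15.5 (p. 253)] -/
@[simp] theorem corrUnits_zero (r : ℕ → (AlgebraicClosure K)ˣ) : F.corrUnits r 0 = r 1 := rfl

omit [NumberField K] [Fact (Nat.Prime p)] in
/-- Unfolding of the recursion step. [cite: Kato2004Asterisque, §15.5 (p. 253)] -/
theorem corrUnits_succ (r : ℕ → (AlgebraicClosure K)ˣ) (t : ℕ) :
    F.corrUnits r (t + 1) = (F.corrUnits r t * (F.cosetNorm (t + 1) (r (t + 2)))⁻¹) ^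
      Nat.card (F.V (t + 1) ⧸ (F.V (t + 2)).subgroupOf (F.V (t + 1))) * r (t + 2) := rfl

omit [NumberField K] [Fact (Nat.Prime p)] in
/-- Unfolding: `z₀ = N₀(z₁)`. [cite: Kato2004Asterisque, §15.5 (p. 253)] -/
@[simp] theorem towerUnits_zero (r : ℕ → (AlgebraicClosure K)ˣ) : F.towerUnits r 0 = F.cosetNorm 0 (r 1) := rfl

omit [NumberField K] [Fact (Nat.Prime p)] in
/-- Unfolding: `z_{t+1} = corrUnits F r t`. [cite: Kato2004Asterisque, §15.5 (p. 253)] -/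
@[simp] theorem towerUnits_succ (r : ℕ → (AlgebraicClosure K)ˣ) (t : ℕ) : F.towerUnits r (t + 1) = F.corrUnits r t :=
  rfl

section Correction

variable (hd : ∀ s, 1 ≤ s → (Nat.card (F.V s ⧸ (F.V (s + 1)).subgroupOf (F.V s))).Coprime 12)
  (r : ℕ → (AlgebraicClosure K)ˣ)
  (hr_fix : ∀ s, 1 ≤ s → ∀ σ : F.V s, (σ : absoluteGaloisGroup K) • r s = r s)
  (hr_norm : ∀ s, 1 ≤ s → ∃ ζ₀ : AlgebraicClosure K, ζ₀ ^ 12 = 1 ∧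
    ((F.cosetNorm s (r (s + 1)) : (AlgebraicClosure K)ˣ) : AlgebraicClosure K) = ζ₀ * r s)

omit [Fact (Nat.Prime p)] in
include hr_fix hr_norm in
/-- **The ratio `θ_t := z_{t+1} · N_{t+1}(r_{t+2})⁻¹` is a `V_{t+1}`-invariant twelfth root of unity**, granted the invariant
`z_{t+1} = η · r_{t+1}` (`η^{12} = 1`, `η` fixed by `V_{t+1}`): `θ_t = η ζ₀⁻¹` where `N_{t+1}(r_{t+2}) = ζ₀ r_{t+1}`.
[cite: deShalit1987, II.2.5 Proposition (i) and II.2.3 (10)] -/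
theorem corrRatio_pow_twelve_of_eq (t : ℕ) {η : (AlgebraicClosure K)ˣ} (hη : η ^ 12 = 1)
    (hηfix : ∀ σ : F.V (t + 1), (σ : absoluteGaloisGroup K) • η = η) (heq : F.corrUnits r t = η * r (t + 1)) :
    (F.corrUnits r t * (F.cosetNorm (t + 1) (r (t + 2)))⁻¹) ^ 12 = 1 ∧
      ∀ σ : F.V (t + 1), (σ : absoluteGaloisGroup K) • (F.corrUnits r t * (F.cosetNorm (t + 1) (r (t + 2)))⁻¹) =
        F.corrUnits r t * (F.cosetNorm (t + 1) (r (t + 2)))⁻¹ := by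
  obtain ⟨ζ₀, hζ₀, hN⟩ := hr_norm (t + 1) (by omega)
  obtain ⟨ζ₀, rfl⟩ := IsUnit.of_pow_eq_one hζ₀ (by norm_num)
  have hζ₀' : ζ₀ ^ 12 = 1 := Units.ext (by rw [Units.val_pow_eq_pow_val, hζ₀, Units.val_one])
  have hN' : F.cosetNorm (t + 1) (r (t + 2)) = ζ₀ * r (t + 1) := Units.ext (by rw [hN, Units.val_mul])
  refine ⟨?_, fun σ ↦ ?_⟩
  · rw [heq, hN', mul_inv_rev, ← mul_assoc, mul_inv_cancel_right, mul_pow, inv_pow, hη, hζ₀', inv_one, mul_one]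
  · rw [smul_mul', smul_inv', F.smul_cosetNorm_of_mem (t + 1) (hr_fix (t + 2) (by omega)) σ, heq, smul_mul',
      hηfix σ, hr_fix (t + 1) (by omega) σ]

omit [Fact (Nat.Prime p)] in
include hr_fix hr_norm in
/-- **The invariant of the recursion**: `z_{t+1} = η_{t+1} · r_{t+1}` with `η_{t+1}^{12} = 1` and `η_{t+1}` fixed by `V_{t+1}`
(induction on `t`: `η₁ = 1`; `η_{t+2} = θ_tᵈ`, `θ_t` the `V_{t+1}`-invariant twelfth root of unity of
`corrRatio_pow_twelve_of_eq`). [cite: Kato2004Asterisque, §15.5 (p. 253)] [cite: deShalit1987, II.2.3 (10)] -/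
theorem exists_corrUnits_eq_mul (t : ℕ) :
    ∃ η : (AlgebraicClosure K)ˣ, η ^ 12 = 1 ∧ (∀ σ : F.V (t + 1), (σ : absoluteGaloisGroup K) • η = η) ∧
      F.corrUnits r t = η * r (t + 1) := by
  induction t with
  | zero => exact ⟨1, one_pow _, fun σ ↦ smul_one _, (one_mul _).symm⟩
  | succ t ih =>
    obtain ⟨η, hη, hηfix, heq⟩ := ih
    obtain ⟨hθ, hθfix⟩ := F.corrRatio_pow_twelve_of_eq r hr_fix hr_norm t hη hηfix heq
    refine ⟨(F.corrUnits r t * (F.cosetNorm (t + 1) (r (t + 2)))⁻¹) ^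
      Nat.card (F.V (t + 1) ⧸ (F.V (t + 2)).subgroupOf (F.V (t + 1))), ?_, fun σ ↦ ?_, F.corrUnits_succ r t⟩
    · rw [pow_right_comm, hθ, one_pow]
    · rw [smul_pow']
      exact congrArg (· ^ _) (hθfix ⟨σ, F.V_succ_le (t + 1) σ.2⟩)

omit [Fact (Nat.Prime p)] in
include hr_fix hr_norm in
/-- **The EXACT norm relation of the corrected units**: `N_{V_{t+1}/V_{t+2}}(z_{t+2}) = z_{t+1}`, granted that
`[V_{t+1} : V_{t+2}]` is prime to `12`: `N(θᵈ · r_{t+2}) = θ^{d²} · N(r_{t+2}) = θ · N(r_{t+2}) = z_{t+1}`.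
[cite: Kato2004Asterisque, §15.5 (p. 253: «the norm map … sends `_𝔞z_{p^{n+1}𝔣}` to `_𝔞z_{pⁿ𝔣}`»)] [cite: deShalit1987,
II.2.5 Proposition (i)] -/
theorem cosetNorm_corrUnits_succ (t : ℕ)
    (hdt : (Nat.card (F.V (t + 1) ⧸ (F.V (t + 2)).subgroupOf (F.V (t + 1)))).Coprime 12) :
    F.cosetNorm (t + 1) (F.corrUnits r (t + 1)) = F.corrUnits r t := by
  obtain ⟨η, hη, hηfix, heq⟩ := F.exists_corrUnits_eq_mul r hr_fix hr_norm t
  obtain ⟨hθ, hθfix⟩ := F.corrRatio_pow_twelve_of_eq r hr_fix hr_norm t hη hηfix heq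
  rw [corrUnits_succ, cosetNorm_mul, F.cosetNorm_eq_pow_of_forall_smul_eq (t + 1) (fun σ ↦ by rw [smul_pow', hθfix σ]),
    pow_pow_self_eq_of_pow_twelve hθ hdt, inv_mul_cancel_right]

omit [Fact (Nat.Prime p)] in
include hd hr_fix hr_norm in
/-- ★★ **A UNIT TOWER from representatives that are norm-compatible up to `μ₁₂`** (Kato §15.5 read through de Shalit's
`Θ = θ^{12}`): on any Kummer frame `F` whose indices `[V_s : V_{s+1}]` (`s ≥ 1`) are prime to `12`, level representatives
`r_s` (`s ≥ 1`) that are `V_s`-invariant, norm-compatible up to twelfth roots of unity (`N_s(r_{s+1}) = ζ₀ r_s`,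
`ζ₀^{12} = 1`, read in `K̄`) and two-sidedly `p`-integral (`pᵏr_s, pᵏr_s⁻¹ ∈ ℤ̄` — the second conjunct of `mem_pUnitsOf_iff`)
admit a unit tower `u` on `F` (ALL fields proved: `smul_z`, the exact `norm_z`, the `p`-unit letter `punit_z`, level `0`
included as `N₀(z₁)`) with `u.z 1 = r 1` and `u.z s = η_s · r_s`, `η_s^{12} = 1`, `η_s` fixed by `V_s` (`s ≥ 1`) — so any
pin that reads only twelfth powers, membership in `K̄^{V_s}` and `p`-unit-ness (e.g. `CM.IsKatoUnitRepAt`) transfers from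
`r_s` to `u.z s`. [cite: Kato2004Asterisque, §15.5 (p. 253)] [cite: deShalit1987, II.2.5 Proposition (i), II.2.4 (iii),
II.2.3 (10)] [cite: JohnsonLeungKings2011, Prop. 3.3 (1)(2)] -/
theorem exists_unitTower_of_reps
    (hr_int : ∀ s, 1 ≤ s → ∃ k : ℕ, IsIntegral ℤ ((p : AlgebraicClosure K) ^ k * (r s : AlgebraicClosure K)) ∧
      IsIntegral ℤ ((p : AlgebraicClosure K) ^ k * ((r s)⁻¹ : (AlgebraicClosure K)ˣ).val)) :
    ∃ u : F.UnitTower, u.z 1 = r 1 ∧ ∀ s, 1 ≤ s →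
      ∃ η : (AlgebraicClosure K)ˣ, η ^ 12 = 1 ∧ (∀ σ : F.V s, (σ : absoluteGaloisGroup K) • η = η) ∧ u.z s = η * r s := by
  -- the corrected units at the levels `≥ 1` are `V`-invariant and two-sidedly `p`-integral
  have hfix : ∀ t (σ : F.V (t + 1)), (σ : absoluteGaloisGroup K) • F.corrUnits r t = F.corrUnits r t := fun t σ ↦ by
    obtain ⟨η, -, hηfix, heq⟩ := F.exists_corrUnits_eq_mul r hr_fix hr_norm t
    rw [heq, smul_mul', hηfix σ, hr_fix (t + 1) (by omega) σ]
  have hint : ∀ t, ∃ k : ℕ, IsIntegral ℤ ((p : AlgebraicClosure K) ^ k * (F.corrUnits r t : AlgebraicClosure K)) ∧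
      IsIntegral ℤ ((p : AlgebraicClosure K) ^ k * ((F.corrUnits r t)⁻¹ : (AlgebraicClosure K)ˣ).val) := fun t ↦ by
    obtain ⟨η, hη, -, heq⟩ := F.exists_corrUnits_eq_mul r hr_fix hr_norm t
    obtain ⟨k, hk, hk'⟩ := hr_int (t + 1) (by omega)
    have hη' : η⁻¹ ^ 12 = 1 := by rw [inv_pow, hη, inv_one]
    refine ⟨k, ?_, ?_⟩
    · rw [heq]
      exact isIntegral_pow_mul_mul_of_pow_twelve hη hk
    · rw [heq, mul_inv]
      exact isIntegral_pow_mul_mul_of_pow_twelve hη' hk'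
  refine ⟨⟨F.towerUnits r, ?_, ?_, ?_⟩, rfl, fun s hs ↦ ?_⟩
  · -- `smul_z`
    rintro (_ | t) σ
    · rw [towerUnits_zero]
      exact F.smul_cosetNorm_of_mem 0 (hfix 0) σ
    · exact hfix t σ
  · -- `norm_z`
    rintro (_ | t) _ t' ht'
    · rw [towerUnits_succ, towerUnits_zero, corrUnits_zero]
      exact F.prod_smul_eq_cosetNorm 0 t' ht' (hfix 0)
    · rw [towerUnits_succ, towerUnits_succ, F.prod_smul_eq_cosetNorm (t + 1) t' ht' (hfix (t + 1))]
      exact F.cosetNorm_corrUnits_succ r hr_fix hr_norm t (hd (t + 1) (by omega))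
  · -- `punit_z`
    rintro (_ | t)
    · obtain ⟨k, hk, hk'⟩ := hint 0
      simp only [corrUnits_zero] at hk hk'
      rw [towerUnits_zero]
      refine punit_of_isIntegral (F.isIntegral_pow_mul_cosetNorm 0 hk) ?_
      rw [← cosetNorm_inv]
      exact F.isIntegral_pow_mul_cosetNorm 0 hk'
    · obtain ⟨k, hk, hk'⟩ := hint t
      exact punit_of_isIntegral hk hk'
  · obtain ⟨t, rfl⟩ : ∃ t, s = t + 1 := ⟨s - 1, by omega⟩
    exact F.exists_corrUnits_eq_mul r hr_fix hr_norm t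

end Correction

end KummerFrame

/-! ## §4 The torsion tower: `[V_s : V_{s+1}]` is a power of `p` for `s ≥ 1` -/

section TorsionTower

variable {K : Type} [Field K] (E : WeierstrassCurve K) {p : ℕ}

/-- **`σ ∈ Gal(K̄/K(E[m]))`, `p ∣ m` ⟹ `σᵖ ∈ Gal(K̄/K(E[pm]))`**: for `P ∈ E[pm]` the point `Q := σP − P` lies in
`E[p] ⊆ E[m]`, so it is fixed by `σ`, whence `σᵏP = P + kQ` and `σᵖP = P + pQ = P`. [cite: deShalit1987, II.1.7 Corollary
(the conjugates of a primitive `𝔤`-division point over `K(𝔤/𝔭)` are its translates by `E[𝔭]`)] [cite: Kato2004Asterisque,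
§15.3 (15.3.1) (p. 252)] -/
theorem pow_mem_torsionLayer_mul {m : ℕ} (hpm : p ∣ m) {σ : absoluteGaloisGroup K} (hσ : σ ∈ CM.torsionLayer E m) :
    σ ^ p ∈ CM.torsionLayer E (p * m) := by
  have hsz : ∀ (n : ℤ) (Q : geomPoints E), σ • (n • Q) = n • σ • Q := fun n Q ↦
    map_zsmul (DistribSMul.toAddMonoidHom (geomPoints E) σ) n Q
  refine mem_torsionLayer_of_forall_smul_eq E fun P hP ↦ ?_
  -- `Q := σ • P - P` is `p`-torsion and `m`-torsion, hence fixed by `σ`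
  have hpP : σ • ((p : ℤ) • P) = (p : ℤ) • P :=
    smul_eq_of_mem_torsionLayer E hσ _ (by rw [← mul_zsmul, ← Nat.cast_mul, mul_comm]; exact hP)
  have hQ : (m : ℤ) • (σ • P - P) = 0 := by
    obtain ⟨c, rfl⟩ := hpm
    rw [Nat.cast_mul, mul_comm, mul_zsmul, zsmul_sub, ← hsz, hpP, sub_self, zsmul_zero]
  have hσQ : σ • (σ • P - P) = σ • P - P := smul_eq_of_mem_torsionLayer E hσ _ hQ
  have hk : ∀ k : ℕ, σ ^ k • P = P + (k : ℤ) • (σ • P - P) := by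
    intro k
    induction k with
    | zero => simp
    | succ k ih =>
      rw [pow_succ', mul_smul, ih, smul_add, hsz, hσQ, Nat.cast_succ, add_zsmul, one_zsmul]
      abel
  have hpQ : (p : ℤ) • (σ • P - P) = 0 := by rw [zsmul_sub, ← hsz, hpP, sub_self]
  rw [hk p, hpQ, add_zero]

variable [E.IsElliptic] (p) [Fact p.Prime] [NumberField K]

/-- **`[Gal(K̄/K(E[m])) : Gal(K̄/K(E[pm]))]` is a power of `p`** for `p ∣ m ≠ 0`: the quotient is a finite group of
exponent `p` (`pow_mem_torsionLayer_mul`). [cite: deShalit1987, II.1.7 Corollary] [cite: Kato2004Asterisque, §15.3 (15.3.1)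
(p. 252)] -/
theorem exists_card_quotient_torsionLayer_eq_pow {m : ℕ} (hm : m ≠ 0) (hpm : p ∣ m) :
    ∃ a : ℕ, Nat.card (CM.torsionLayer E m ⧸ (CM.torsionLayer E (p * m)).subgroupOf (CM.torsionLayer E m)) = p ^ a := by
  have hp : p.Prime := Fact.out
  haveI : (CM.torsionLayer E (p * m)).FiniteIndex := finiteIndex_of_isOpen_of_compactSpace _
    (WeierstrassCurve.isOpen_ker_galoisRepTorsion_holds E (n := ((p * m : ℕ) : ℤ))
      (by exact_mod_cast mul_ne_zero hp.ne_zero hm))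
  refine IsPGroup.iff_card.mp fun x ↦ ⟨1, ?_⟩
  obtain ⟨σ, rfl⟩ := QuotientGroup.mk_surjective x
  rw [pow_one, ← QuotientGroup.mk_pow, QuotientGroup.eq_one_iff, Subgroup.mem_subgroupOf, Subgroup.coe_pow]
  exact pow_mem_torsionLayer_mul E hpm σ.2

/-- **The index `[Gal(K̄/K(E[m])) : Gal(K̄/K(E[pm]))]` is prime to `12`** for `p ∤ 12`, `p ∣ m ≠ 0`.
[cite: deShalit1987, II.1.7 Corollary] [cite: Kato2004Asterisque, §15.3 (15.3.1) (p. 252)] -/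
theorem coprime_card_quotient_torsionLayer {m : ℕ} (hm : m ≠ 0) (hpm : p ∣ m) (hp : p.Coprime 12) :
    (Nat.card (CM.torsionLayer E m ⧸ (CM.torsionLayer E (p * m)).subgroupOf (CM.torsionLayer E m))).Coprime 12 := by
  obtain ⟨a, ha⟩ := exists_card_quotient_torsionLayer_eq_pow E p hm hpm
  rw [ha]
  exact Nat.Coprime.pow_left a hp

namespace KummerFrame

variable (f : ℕ) (hf : 0 < f) (γ : E.tateModule p)

/-- **The indices of the torsion-tower frame are prime to `12`** for `p ∤ 12` and `s ≥ 1`: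
`[V_s : V_{s+1}] = [Gal(K̄/K(E[pˢf])) : Gal(K̄/K(E[p^{s+1}f]))] = pᵃ`. [cite: Kato2004Asterisque, §15.5 (p. 253)]
[cite: deShalit1987, II.1.7 Corollary] -/
theorem coprime_card_quotient_ofTorsionTower (hp : p.Coprime 12) {s : ℕ} (hs : 1 ≤ s) :
    (Nat.card ((ofTorsionTower E p f hf γ).V s ⧸
      ((ofTorsionTower E p f hf γ).V (s + 1)).subgroupOf ((ofTorsionTower E p f hf γ).V s))).Coprime 12 := by
  have hp' : p.Prime := Fact.out
  have hmul : p ^ (s + 1) * f = p * (p ^ s * f) := by rw [pow_succ]; ring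
  show (Nat.card (CM.torsionLayer E (p ^ s * f) ⧸
    (CM.torsionLayer E (p ^ (s + 1) * f)).subgroupOf (CM.torsionLayer E (p ^ s * f)))).Coprime 12
  rw [hmul]
  exact coprime_card_quotient_torsionLayer E p (mul_ne_zero (pow_ne_zero s hp'.ne_zero) hf.ne')
    (dvd_mul_of_dvd_left (dvd_pow_self p (by omega)) f) hp

/-- ★★ **A UNIT TOWER ON THE TORSION-TOWER FRAME from representatives norm-compatible up to `μ₁₂`** — the (F∃)-2b input:
for `p ∤ 12`, on `KummerFrame.ofTorsionTower E p f hf γ` (`V s = Gal(K̄/K(E[pˢf]))`; for a CM curve with `cond ∣ (f)`: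
`= Gal(K̄/K(pˢ𝔣))`), `V_s`-invariant, two-sidedly `p`-integral level representatives `r_s` (`s ≥ 1`) with
`N_s(r_{s+1}) = ζ₀ r_s`, `ζ₀^{12} = 1` yield a unit tower `u` with `u.z 1 = r 1` and `u.z s = η_s r_s`, `η_s^{12} = 1`, `η_s`
fixed by `V_s` (`s ≥ 1`) (`exists_unitTower_of_reps` + `coprime_card_quotient_ofTorsionTower`).  At the consumer:
`r_s` = Kato's representatives of `_𝔞z_{pˢ𝔣}` (`Kato2004.sec155_exists_katoUnitRep`), the norm relation from de Shalit
II.2.5 (i) (`exists_normOver_katoUnitRep_eq_mul` + `prod_smul_eq_normOver_of_eq` + `CM.torsionLayer_eq_fixingSubgroup_katoLayer`).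
[cite: Kato2004Asterisque, §15.5 (p. 253)] [cite: deShalit1987, II.2.5 Proposition (i), II.1.7 Corollary] -/
theorem exists_unitTower_ofTorsionTower_of_reps (hp : p.Coprime 12) (r : ℕ → (AlgebraicClosure K)ˣ)
    (hr_fix : ∀ s, 1 ≤ s → ∀ σ : (ofTorsionTower E p f hf γ).V s, (σ : absoluteGaloisGroup K) • r s = r s)
    (hr_norm : ∀ s, 1 ≤ s → ∃ ζ₀ : AlgebraicClosure K, ζ₀ ^ 12 = 1 ∧
      (((ofTorsionTower E p f hf γ).cosetNorm s (r (s + 1)) : (AlgebraicClosure K)ˣ) : AlgebraicClosure K) = ζ₀ * r s)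
    (hr_int : ∀ s, 1 ≤ s → ∃ k : ℕ, IsIntegral ℤ ((p : AlgebraicClosure K) ^ k * (r s : AlgebraicClosure K)) ∧
      IsIntegral ℤ ((p : AlgebraicClosure K) ^ k * ((r s)⁻¹ : (AlgebraicClosure K)ˣ).val)) :
    ∃ u : (ofTorsionTower E p f hf γ).UnitTower, u.z 1 = r 1 ∧ ∀ s, 1 ≤ s →
      ∃ η : (AlgebraicClosure K)ˣ, η ^ 12 = 1 ∧
        (∀ σ : (ofTorsionTower E p f hf γ).V s, (σ : absoluteGaloisGroup K) • η = η) ∧ u.z s = η * r s :=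
  (ofTorsionTower E p f hf γ).exists_unitTower_of_reps (fun _ hs ↦ coprime_card_quotient_ofTorsionTower E p f hf γ hp hs)
    r hr_fix hr_norm hr_int

end KummerFrame

end TorsionTower

end Literature.NumberTheory.EllipticCurves.Kato2004

end
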